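import Mathlib
import HarnessLib
import Summits.NavierStokesRegularity.NavierStokesRegularity.Theses.LocalOneDirectionTubeDoor
import Summits.NavierStokesRegularity.NavierStokesRegularity.Theorems.LocalSineTubeDoorOneDirectionDoor

/-!
# Route `LocalOneDirectionTubeDoor` (S13, rung N0-LocalTubeDoorOneDirection) — crux K2 `OneDirectionWindowRigidity` is a THEOREM

Cell ns-regularity-ideate, seat p6 (birth filing; the route was opened from the staged package
HOME/ns-regularity-ideate-p6/route-onedirection/).  The crux says: a profile of the Type-I class (rate, continuity,
unit-viscosity Oseen–Duhamel identity, divergence-free) has (i) continuous gradient slices `fderiv ℝ (v s)` and (ii) for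
every fixed `e ≠ 0`, if every slice carries a nonempty open set on which `∂ₑ v(s,·) = fderiv ℝ (v s) · e` vanishes, then
`v` is not backward-singular at the apex.  (i): slices are real-analytic (`analyticOnNhd_slice`), hence `C¹`; (ii): the
window crux `windowCrux_dirDerivNorm` (p456214: window ⇒ whole slice by analyticity ⇒ the slice is translation-invariant
along `e` ⇒ trivial by the one-slice translation stratum).  Closing item stmt-NavierStokesRegularity-20265.

WHAT THIS IS NOT: not a claim about Navier–Stokes regularity (Clay A).  The leaf is a regularity CRITERION (local Type I
+ L¹-fading of the scale-normalised directional derivative (T−t)·∂ₑu, for every fixed e ≠ 0, on ONE similarity window ⇒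
backward bounded), one rung of LADDER-NS N0 (N0-LocalTubeDoorOneDirection); establishment in the cell's sense still
requires the cross-family referee PASS + independent reproduction.
-/

noncomputable section

-- the summit and its single sub-problem share the name (CONVENTIONS §1), as in every Theorems file
set_option linter.dupNamespace false

namespace Summit.NavierStokesRegularity.NavierStokesRegularity.Theorems.LocalOneDirectionTubeDoorOneDirectionWindowRigidityClose

open Set Literature.Analysis Literature.Analysis.FluidPDE
open Summit.NavierStokesRegularity.NavierStokesRegularity.Theorems.LocalSineTubeDoorProfileAlignedWindowRigidityAncient
open Summit.NavierStokesRegularity.NavierStokesRegularity.Theorems.LocalSineTubeDoorOneDirectionDoor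

/-- **Crux K2 `OneDirectionWindowRigidity` (item stmt-NavierStokesRegularity-20265) is a THEOREM**: continuity of the gradient slices
from slice analyticity, rigidity from `windowCrux_dirDerivNorm` (p456214) after `norm_eq_zero`. -/
theorem oneDirectionWindowRigidity_proof :
    Summit.NavierStokesRegularity.NavierStokesRegularity.Theses.LocalOneDirectionTubeDoor.OneDirectionWindowRigidity := by
  intro C v hr hc hm hd
  refine ⟨fun s hs => ?_, fun e he hwin => ?_⟩
  · exact ((analyticOnNhd_slice hc (bdd_of_hasTypeITimeDecay hr) hm hs).contDiff (n := 1)).continuous_fderiv one_ne_zero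
  · refine windowCrux_dirDerivNorm he C v hr hc hm hd fun s hs => ?_
    obtain ⟨U, hU, hne, hal⟩ := hwin s hs
    exact ⟨U, hU, hne, fun y hy => by simpa only [norm_eq_zero] using hal y hy⟩

end Summit.NavierStokesRegularity.NavierStokesRegularity.Theorems.LocalOneDirectionTubeDoorOneDirectionWindowRigidityClose

end
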